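import Literature.NumberTheory.GaloisRepresentations.OrdinaryCrystallineSymplecticLift
import HarnessLib

/-!
# Ordinary crystalline symplectic lifts of `p`-distinguished ordinary `ρ̄ : Γ_{ℚ_p} → GSp₄(𝔽̄_p)`,
# without genericity (Yamauchi 2020, §9.4.1 with Prop. 9.12 and 9.16–9.18; generic case:
# Gee–Geraghty 2012, Lemma 7.6.7)

Topic `Literature/NumberTheory/GaloisRepresentations`; sequel of `OrdinaryCrystallineSymplecticLift`
(interface `IsOrdinarySymplecticLocalLiftAt`; generic case `GeeGeraghty2012_lem767_ordinarySymplecticLift_rat`).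
Cite item of the crux `stmt-Langlands-17765`
(`Summit.Langlands.Langlands.Theses.AbelianSurfaceSerre.SerreGSp4Surjective`), line
`singer-type-evaporation`, stub `stub_liftExists`, whose hypothesis (H2) `OrdinaryDistinguishedAt`
asks for pairwise DISTINCT diagonal characters but NOT for genericity (`μ̄_iμ̄_j⁻¹ ≠ ε̄`).  ONE NAMED
FACT (D-0014), `Yamauchi2020_sec941_ordinarySymplecticLift_rat`: the local lifting statement of the
companion file WITHOUT the genericity hypothesis, as printed (for `K = ℚ_p`, the Borel-ordinary case
of `GSp₄`) in T. Yamauchi's preprint.  READ THE CAVEAT BELOW: this is the one link of the chain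
behind `stub_liftExists` whose printed proof the vendor (this file's author) could not fully verify;
it is vendored SEPARATELY from the generic case so that an auditor may grade it on its own.

## The printed statements (held text arXiv:2006.07824, read 2026-08-17)

T. Yamauchi, *Serre weights for `GSp₄` over totally real fields*, arXiv:2006.07824 [Yamauchi2020]
(preprint; §9 "Potentially diagonalizable, crystalline lifts with prescribed types", standing:
"In this section, we study how we can lift given mod `p` local Galois representations … We note that
`p = 2` is allowed in this section"; §9.3 "Exhaustion of `H¹(ℚ_p, T̄)` by crystalline objects":
"In this subsection, we suppose `K = ℚ_p` for simplicity").

* **§9.4** "An explicit construction of potentially diagonalizable, crystalline lifts for `GSp₄`"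
  (p. 39), verbatim: "Let `ρ̄ : G_{ℚ_p} → GSp₄(𝔽̄_p)` be a continuous representation. Assume `p > 2`
  for simplicity. It is easy to see that the similitude character `ν ∘ ρ̄` is the product of a power
  of `ε̄` and an unramified character. We regard `ρ̄` as a representation to `GL₄(𝔽̄_p)` and denote
  by `ρ̄^{ss}` the semi-simplification of `ρ̄`. By Proposition 7.2 of [Yamauchi, earlier paper] we
  have five types: • (Borel ordinary case) `ρ̄^{ss}` is decomposed into the direct sum of
  characters; • (Siegel ordinary case) …; • (Klingen ordinary case) …; • (Endoscopic case) …;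
  • (Irreducible case) …".  **§9.4.1 Borel ordinary case**, verbatim: "In this case, it follows from
  Proposition 7.2 of [loc. cit.] that `ρ̄ ≃ ε̄^c ψ̄₀ ⊗ (ρ̄₁ B; 0₂ ψ̄₁ε̄^{a+b} ρ̄₁^*)`.  Here
  `ρ̄₁ = (ψ̄₁ε̄^{a+b} τ̄₀; 0 ψ̄₂ε̄^a)` and for each `0 ≤ i ≤ 2`, `ψ̄_i : G_{ℚ_p} → 𝔽̄_p^×` is an
  unramified character and `0 ≤ a, b, c ≤ p - 2`.  Notice that the class of `B` belongs to
  `H¹(ℚ_p, (ψ̄₁ε̄^{a+b})⁻¹ Sym²(ρ̄₁))` where the space `(ψ̄₁ε̄^{a+b})⁻¹Sym²(ρ̄₁)` is of dimension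
  three and `Sym²(ρ̄₁)` stands for the symmetric square representation of `ρ̄₁`.  Then, by
  Proposition 9.17, there exists a crystalline lift of `ρ̄` to `GSp₄(𝒪)` with regular Hodge–Tate
  weights. Since such a lift is ordinary, it is also potentially diagonalizable."
* **Proposition 9.16** (p. 38), verbatim: "Let `p ≥ 2` be a prime. Let `ρ̄ = (χ̄₁ τ̄; 0 χ̄₂)`. Then
  each class of `H¹(ℚ_p, ρ̄)` is liftable to an ordinary, crystalline extension with specific regular
  Hodge–Tate weights."  **Proposition 9.17** (p. 38): "[for `ρ̄ : G_{ℚ_p} → GL₃(𝔽̄_p)` upper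
  triangular with diagonal `ψ̄₁ε̄^a, ψ̄₂ε̄^b, ψ̄₃ε̄^c`] Each element `x ∈ H¹(ℚ_p, ρ̄)` is liftable to a
  rank one `𝒪`-submodule in `H¹_f(ρ_{χ₁,χ₂,χ₃})` for `ρ_{χ₁,χ₂,χ₃}` with specific characters `χ_i` with
  regular Hodge–Tate weights."  **Proposition 9.12 (2)** (p. 35; the très ramifiée classes, after
  Khare–Wintenberger, *Serre's modularity conjecture I*, Prop. 3.5): "Assume `(b̄, ψ̄) = (1̄, 1)` and
  `p > 2`. • For any integer `k ≥ 0`, each peu ramifiée class `α` of `H¹(ℚ_p, ε̄)` is liftable to a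
  class of `H¹_f(ℚ_p, T_{1+k(p-1),ψ_α})` for some unramified lift `ψ_α` of `ψ̄` with `c(ψ_α) = 1`.
  • For any integer `k ≥ 1`, each très ramifiée class of `H¹(ℚ_p, ε̄)` is liftable to a class of
  `H¹_f(ℚ_p, T_{1+k(p-1),ψ_α})` for some unramified lift `ψ_α` of `ψ̄` with `c(ψ_α ε^{p-1}) = 1`."
* Generic case, rigorous and published: Gee–Geraghty 2012, Lemma 7.6.7 (companion file).

## CAVEAT (auditor, please read)

In the GENERIC case (no `μ̄_iμ̄_j⁻¹ = ε̄`) the statement is Gee–Geraghty's Lemma 7.6.7 (`H²(G_M, 𝔲) = 0`).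
In the NON-generic case the only printed source found in the held literature is the passage of
[Yamauchi2020] §9.4.1 quoted above, which (a) is a preprint, and (b) argues by reducing the
`GSp₄`-valued lifting problem to lifting the Siegel-shaped extension class
`B ∈ H¹(ℚ_p, ν̄⁻¹Sym²ρ̄₁)` through Prop. 9.17 — whose `3`-dimensional crystalline lift
`ρ_{χ₁,χ₂,χ₃}` of `ν̄⁻¹Sym²ρ̄₁` must moreover be OF THE FORM `ν⁻¹Sym²ρ₁` for a crystalline ordinary
lift `ρ₁` of `ρ̄₁` in order to produce a `GSp₄`-valued lift; the printed text does not spell this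
out.  The vendor regards the STATEMENT as standard folklore (the "vary the unramified twist and the
weight by multiples of `p - 1`" argument of Khare–Wintenberger Prop. 3.5 / Prop. 9.12 (2) above,
cf. Emerton–Gee, *Moduli stacks of étale (φ,Γ)-modules*, Lemma 5.5.4 for `GL_d` and maximally
non-split `ρ̄`) but NOT as rigorously in print for `GSp₄`; every result through this fact is
conditional on it (D-0014), and the generic case should be preferred where it suffices.

## The rendering

Identical to `GeeGeraghty2012_lem767_ordinarySymplecticLift_rat` (companion file; see its module
docstring, steps 1–4, for the translation of the crux's clauses into the upper-triangular
symplectic shape and back) with the genericity clause REMOVED: `p ≥ 3`; `ρ̄ : Γ_ℚ → GL₄(𝔽_p)`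
preserving an alternating non-degenerate `J` up to `ε̄_p⁻¹`; at the place `v ∣ p` a frame over
`𝔽̄_p` in which `ρ̄|Γ_{ℚ_v}` is upper triangular with pairwise distinct diagonal characters (VERBATIM
the clause of the crux's (H2) `OrdinaryDistinguishedAt`); conclusion: strictly decreasing exponents
`e` and a crystalline ordinary symplectic lift `r_v` of `ρ̄|Γ_{ℚ_v}` with exponents `e` and
multiplier `ε_p⁻¹` (`IsOrdinarySymplecticLocalLiftAt`).  In Yamauchi's notation the Borel-ordinary
`ρ̄` has diagonal `(ψ̄₀ψ̄₁ε̄^{a+b+c}, ψ̄₀ψ̄₂ε̄^{a+c}, ψ̄₀ψ̄₂⁻¹ε̄^{b+c}, ψ̄₀ψ̄₁⁻¹ε̄^{c})` and similitude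
`ν̄ = ψ̄₀²ε̄^{a+b+2c}`; ours is the case `ν̄ = ε̄⁻¹`.  The printed statement gives a crystalline lift
`ρ : G_{ℚ_p} → GSp₄(𝒪)` with regular Hodge–Tate weights which is ordinary (upper triangular with
crystalline diagonal characters `u_i ε^{e_i}`, `u_i` unramified, `e` strictly decreasing — the
characters of §9.3 are all of this form), of SOME crystalline similitude `ν = u ε^m` lifting `ε̄⁻¹`
(`ū = 1`, `m ≡ -1 (mod p-1)`); the weights in the construction are free up to shifts by multiples
of `p - 1` (Prop. 9.12 and 9.16: "for any integer `k ≥ 1`"), which allows `m + 1 ≡ 0 (mod 2(p-1))`,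
and then the twist of `ρ` by the crystalline character `u^{-1/2} ε^{-(m+1)/2}` (of trivial reduction:
`(p-1) ∣ (m+1)/2`, and `u(Frob) ∈ 1 + 𝔪` has a square root since `p` is odd) still lifts `ρ̄`, is
crystalline ordinary with shifted exponents, and has similitude EXACTLY `ε⁻¹` — clauses (iii)–(iv)
of the interface; clauses (i)–(ii) as in steps 1 and 4 of the companion file.
* WEAKER than print / NOT here:
  -- TODO(general form): finite `K/ℚ_p` (Yamauchi: `K = ℚ_p`), residual coefficients a general
  -- finite `k`, the four non-Borel types of §9.4, potential diagonalizability of the lift.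

## References

* [Yamauchi2020] T. Yamauchi, arXiv:2006.07824, §9.3 (Prop. 9.12, 9.16–9.18) and §9.4.1 (pp. 33–39).
* [GeeGeraghty2012] Duke Math. J. 161 (2012), Lemma 7.6.7 (the generic case).
* [KhareWintenberger2009I] C. Khare, J.-P. Wintenberger, Invent. Math. 178 (2009), Prop. 3.5
  (weight `p + 1` lifts of très ramifiée classes).
* [EmertonGee2022] M. Emerton, T. Gee, Ann. of Math. Stud. 215, Lemma 5.5.4 (ordinary crystalline
  lifts of maximally non-split `ρ̄`, `GL_d`).
-/

noncomputable section

open scoped MatrixGroups Matrix NumberField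
open NumberField IsDedekindDomain Field Filter

namespace Literature.NumberTheory.GaloisRepresentations

/-- **Crystalline ordinary symplectic lifts of `p`-distinguished Borel-ordinary
`ρ̄|Γ_{ℚ_p} : Γ_{ℚ_p} → GSp₄(𝔽̄_p)`, WITHOUT genericity** (Yamauchi 2020, §9.4.1 "Borel ordinary
case" with Prop. 9.12, 9.16–9.18; generic case = Gee–Geraghty 2012, Lemma 7.6.7 — see the module
docstring for the printed statements, the rendering, and the CAVEAT on the printed proof in the
non-generic case).  Let `p ≥ 3` be prime and `ρ̄ : Γ_ℚ → GL₄(𝔽_p)` continuous, preserving an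
alternating non-degenerate `J` up to the multiplier `ε̄_p⁻¹` (the crux's (H1) without its image
clause); let `v` be the place of `ℚ` above `p` and suppose that in some frame over `𝔽̄_p` the
restriction `ρ̄|Γ_{ℚ_v}` is UPPER TRIANGULAR with PAIRWISE DISTINCT diagonal characters (the crux's
(H2) at `v`, verbatim).  THEN there are strictly decreasing integers `e` and a crystalline ordinary
symplectic lift `r_v : Γ_{ℚ_v} → GL₄(ℚ̄_p)` of `ρ̄|Γ_{ℚ_v}` with exponents `e` and multiplier `ε_p⁻¹`
(`IsOrdinarySymplecticLocalLiftAt`).  Printed ([Yamauchi2020] §9.4.1): "(Borel ordinary case) …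
Then, by Proposition 9.17, there exists a crystalline lift of `ρ̄` to `GSp₄(𝒪)` with regular
Hodge–Tate weights. Since such a lift is ordinary, it is also potentially diagonalizable."  Named fact
(D-0014); users take `(h : Yamauchi2020_sec941_ordinarySymplecticLift_rat)`; PREFER the generic
`GeeGeraghty2012_lem767_ordinarySymplecticLift_rat` where a genericity hypothesis is available.
-- TODO(general form): finite `K/ℚ_p`, general finite residual coefficients, the non-Borel types.
[cite: Yamauchi2020, §9.4.1 with Prop. 9.12 and Prop. 9.16–9.18]
[cite: GeeGeraghty2012, Lemma 7.6.7] -/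
def Yamauchi2020_sec941_ordinarySymplecticLift_rat : Prop :=
  ∀ (p : ℕ) [Fact p.Prime], 3 ≤ p →
    ∀ (ρ : FramedGaloisRep ℚ (ZMod p) 4) (J : Matrix (Fin 4) (Fin 4) (ZMod p)),
      -- `ρ̄ : Γ_ℚ → GSp(J)(𝔽_p)` with multiplier `ε̄_p⁻¹`
      Jᵀ = -J → IsUnit J.det →
      (∀ g : absoluteGaloisGroup ℚ, (ρ g).valᵀ * J * (ρ g).val =
        (((modPCyclotomicCharacterZMod ℚ p g)⁻¹ : (ZMod p)ˣ) : ZMod p) • J) →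
    ∀ (v : HeightOneSpectrum (𝓞 ℚ)) (hv : ((p : ℕ) : 𝓞 ℚ) ∈ v.asIdeal),
      -- at `v ∣ p`: upper triangular over `𝔽̄_p` with pairwise distinct diagonal characters
      -- (VERBATIM the clause of the crux's (H2) `OrdinaryDistinguishedAt` at `v`)
      (∃ g : GL (Fin 4) (AlgebraicClosure (ZMod p)),
        (∀ (τ : absoluteGaloisGroup (v.adicCompletion ℚ)) (i j : Fin 4), j < i →
          (g.val * ((ρ.toLocal v τ).val.map (algebraMap (ZMod p) (AlgebraicClosure (ZMod p)))) *
            (g⁻¹).val) i j = 0) ∧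
        (∀ i j : Fin 4, i ≠ j → ∃ τ : absoluteGaloisGroup (v.adicCompletion ℚ),
          (g.val * ((ρ.toLocal v τ).val.map (algebraMap (ZMod p) (AlgebraicClosure (ZMod p)))) *
              (g⁻¹).val) i i ≠
            (g.val * ((ρ.toLocal v τ).val.map (algebraMap (ZMod p) (AlgebraicClosure (ZMod p)))) *
              (g⁻¹).val) j j)) →
      -- CONCLUSION: a crystalline ordinary symplectic lift with strictly decreasing exponents
      ∃ (e : Fin 4 → ℤ) (rv : FramedRep (absoluteGaloisGroup (v.adicCompletion ℚ)) (PadicAlgCl p) 4),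
        StrictAnti e ∧ IsOrdinarySymplecticLocalLiftAt p ρ J v hv e rv

end Literature.NumberTheory.GaloisRepresentations

end
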